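import Mathlib
import HarnessLib

/-!
# Liu 2021, Appendix B «Poles of Eisenstein series and theta lifting for unitary groups»: Theorem B.4, Corollary B.5, Corollary B.6 (1)
# AS PRINTED, as a typed dictionary, with the two deductions the proof of Proposition 4.13 (Case 1) draws from them PROVED

Reproduction (typed skeleton, DICTIONARY LEVEL — read «Transcription level» below) of Y. Liu, *Fourier–Jacobi cycles and arithmetic relative trace
formula*, Camb. J. Math. **9** (2021) 1–147 = arXiv:2102.11518 [Liu2021], **Appendix B** (print pp. 95–106; TeX of record `FJcycle.tex` l. 4218–4546): Def. B.2
(`de:realization`, l. 4232, p. 96), Def. B.3 (`de:strictly_unitary`, l. 4249, p. 96), the convention l. 4274 (p. 97), **Theorem B.4** (`th:pole`, l. 4278–4299,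
p. 98), **Corollary B.5** (`co:pole1`, l. 4301–4313, p. 98), **Corollary B.6 (1)** (`co:pole2`, l. 4319–4326, p. 99), together with the Remark after Def. 4.1
(l. 1904–1906, p. 41).  These are nodes N2, N3, N4, N6 of the T5 payability map `F0/P2/T5b-TREE.md` (cell hodgecm-mathlib, programme P8 «(C♯)hol interior»): the
printed road from a pole of `L^S(s, π × μ)` to «`V_π = Θ^V_{−W}(π_W)`» behind letter #87 `Literature.NumberTheory.Rogawski1990.cohFinComponent_isThetaSigned_hol`
and its Lines-draft stub `StubHolCotMeetsThetaLine` ∕ typ-T5a's `Liu2021.cohCuspidal_isThetaLiftFromLine`.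

VERBATIM (FJcycle.tex; print identical).  l. 4274: «We will adopt the convention that if `μ|𝔸_F^× ≠ μ_{E/F}^m` with `m := dim_E W`, then `Θ^W_{(μ,ν),V}(V_π) = 0`.»
**Theorem B.4** (l. 4278–4299): «Let `π` be an irreducible admissible representation of `G(𝔸_F)`, let `V_π` be a cuspidal realization of `π` (Definition B.2), and let
`μ : E^×\𝔸_E^× → ℂ^×` be a strictly unitary automorphic character. We have (1) For `s₀ ∈ ℂ` with `Re(s₀) > 0`, consider the following statements: (a)
`L^S(s, π × μ) · L^S(2s, μ, As^{(−1)^n})` has a pole at `s₀` …; (b) `{E_Q(g; f_s) | f ∈ I(V_π ⊠ μᶜ)}` has a pole at `s₀ + j` for some integer `j ≥ 0`; (c)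
`Θ^W_{(μ,ν),V}(V_π) ≠ 0` for some skew-hermitian space `W` of dimension `n + 1 − 2s₀` and some `ν` with `ν|𝔸_F^× = μ_{E/F}^n`. [footnote: This property is independent
of the choice of such `ν` …] Then (a) ⇒ (b) ⇒ (c). (2) The skew-hermitian space `W` in (1c) is unique up to isomorphism.»  «We have the following theorem, which is the
unitary version of a weaker form of [GJS, Theorem 1.1].» (l. 4276).  **Corollary B.5** (l. 4301–4309): «Denote the set of poles of `L^S(s, π × μ) · L^S(2s, μ, As^{(−1)^n})`
in the region `Re(s) > 0` by `Pol^S_{π,μ}`. Then (1) If `μ` is not conjugate self-dual, then `Pol^S_{π,μ}` is empty. (2) If `μ` is conjugate orthogonal (Definition 4.1),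
then `Pol^S_{π,μ}` is contained in the set `{(n+1)/2, (n−1)/2, …, (n+1)/2 − ⌊n/2⌋}`. (3) If `μ` is conjugate symplectic (Definition 4.1), then `Pol^S_{π,μ}` is contained in
the set `{n/2, (n−2)/2, …, n/2 − ⌊(n−1)/2⌋}`.»  Proof (l. 4311–4313): «This is a direct consequence of Theorem B.4.»  **Corollary B.6 (1)** (l. 4319–4326): «Let the
notation be as above. Suppose that `Θ^W_{(μ,ν),V}(V_π)` is cuspidal. Then (1) The space `Θ^W_{(μ,ν),V}(V_π)` is an irreducible representation of `U(W)(𝔸_F)`; and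
`V_π = Θ^V_{(μ⁻¹,ν⁻¹),−W}(Θ^W_{(μ,ν),V}(V_π))` …» (proof l. 4339: «the irreducibility follows from [Wu13, Theorem 5.3], and (B.1) follows from [Wu13, Theorem 5.1]»).
Remark after Def. 4.1 (l. 1904–1906): «A conjugate self-dual automorphic character is necessarily strictly unitary (Definition B.3). It is either conjugate orthogonal
or conjugate symplectic, but not both.»  USE in the proof of Prop. 4.13, Case 1 (l. 2133–2137, p. 48): «there exists a strictly unitary automorphic character … `μ` …
such that the partial `L`-function `L^S(s, π × μ)` has a simple pole at `s₀` with `s₀ ≥ n/2` … By Corollary B.5, `s₀` is either `(n+1)/2` or `n/2`, not both. If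
`s₀ = (n+1)/2`, then Theorem B.4 implies that `Θ^W_{(μ,ν),V}(V_π) ≠ {0}`, where `W` is the zero skew-hermitian space. By Corollary B.6 (1), `V_π` is a character …
Thus, we must have `s₀ = n/2`. By Theorem B.4, we have a one-dimensional skew-hermitian space `W` such that `Θ^W_{(μ,ν),V}(V_π)` [is non-zero] and is cuspidal.»

SETTING (verbatim, l. 4247–4275, p. 96–97): «Now we let `F` be a totally real number field, and `E/F` a totally imaginary quadratic extension. … Let `V` … be a
(non-degenerate) hermitian space over `E` … of rank `n` and let `W` … be a (non-degenerate) skew-hermitian space over `E` … of rank `m`. Let `G := U(V)` and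
`H := U(W)` … we obtain the Weil representation `ω^{V,W}_μ := ω ∘ ι_μ` of `G(𝔸_F) × H(𝔸_F)`. It induces the global theta lifting map `Θ^W_{μ,V}` … `Θ^W_{μ,V}(V)` is spanned
by functions `h ↦ ∫_{G(F)\G(𝔸_F)} θ_μ(g,h) f(g) dg` … for `f ∈ V`.»

STATUS OF THE PRINTED PROOF (quoted, not adjudicated).  Thm. B.4 is proved in §B.3 (l. 4356–4541, pp. 100–105) «follow[ing] the strategy in [GJS]» = D. Ginzburg, D. Jiang,
D. Soudry, J. Inst. Math. Jussieu 8 (2009) 693–741 [GinzburgJiangSoudry2009] (orthogonal groups), through Prop. B.8 and Lem. B.9–B.12, resting on: C. Mœglin, J. Lie Theory 7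
(1997) Rem. 1.1, §2.1, Prop. 2.1, pp. 214–215; V. Tan, Canad. J. Math. 51 (1999) Main Theorem (poles of Siegel Eisenstein series on `U(n,n)`); S. Kudla, W. J. Sweet, Israel
J. Math. 98 (1997) Thm. 1.2–1.3 and S. T. Lee, J. Funct. Anal. 126 (1994) Thm. 6.10 (Siegel–Weil sections surjective); A. Ichino, Math. Z. 247 (2004) main theorem p. 243
(regularised Siegel–Weil formula for unitary groups); [HarrisKudlaSweet1996, Lemma 1.1] (seesaw splitting); H. Kim, Canad. J. Math. 51 (1999) Cor. 2.2; Langlands–Shahidi and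
Gindikin–Karpelevich for the constant terms ([GJS, Prop. 2.2]); Rallis' tower property; (2) = [SunZhu2014, Thm. 1.10] (conservation ∕ theta dichotomy).  A PUBLISHED
unitary-group form of (1) (a)⇒(c) with full proof: D. Jiang, C. Wu, J. Number Theory 161 (2016) 88–118 = arXiv:1409.0767 [JiangWu2014], Thm. 3.1 ∕ Thm. 3.3 (1) («Assume
that the partial `L`-function `L^S(s, σ × χ)` has a pole at `s = ½(m+1−ε_χ) − j > 0` … Then `LO_{ψ,χ}(σ ⊗ χ⁻¹) ≤ 2j + ε_χ`», for `σ` cuspidal on the unitary group of a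
skew-hermitian `X` of dimension `m`, lifting to hermitian `Y`; proof by the regularised Siegel–Weil formula), strengthened to an equality with the maximal Eisenstein pole in
C. Wu, Pacific J. Math. 317 (2022) 207–237 = arXiv:2104.11954 [Wu2022], Thm. 1.  Cor. B.6 (1) = [Wu2013] C. Wu, J. Number Theory 133 (2013) 3296–3318, Thm. 5.1, Thm. 5.3.

## Transcription level

Mathlib (and the tree, for `U(n)` with `n ≥ 2`) has no partial `L`-functions `L^S(s, π × μ)` of automorphic representations of unitary groups, no Eisenstein series on
`U(V ⊕ D)` and no regularised Siegel–Weil formula (census `F0/P2/T5b-TREE.md`, nodes N1–N2: ✗V).  Exactly as in ★ `Literature/RepresentationTheory/BergeronMillsonMoeglin2016/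
{ThetaLiftExhaustion,GlobalToLocalStep}.lean`, the objects the printed statements quantify over are POSITED as the fields of ONE dictionary `ThetaPoleDictionary` (types,
functions, relations; NO propositional field), for ONE pair `(E/F, V)` of rank `n` with its additive character `ψ_F`, and every printed statement is a predicate
`def … (X : ThetaPoleDictionary) : Prop` whose docstring starts with its class: **P** = VERBATIM quotation with locator (`Convention`, `Exclusive`, `ThmB4_1`, `ThmB4_2`,
`CorB5`, `CorB6_1`, `ZeroDimLiftIsCharacter`); **K** = PROVED here from P-statements by elementary logic ∕ arithmetic: `isConjSelfDual_of_hasPole`, `corB5_orth_of_thmB4`,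
`corB5_sympl_of_thmB4`, `corB5_of_thmB4` («This is a direct consequence of Theorem B.4» — kernel-checked, given the convention l. 4274 and the Remark after Def. 4.1), and
`case1_dichotomy` ∕ `case1_line` (the two sentences of the proof of Prop. 4.13 Case 1 that turn `s₀ ≥ n/2` into «`W = 0` and `V_π` is a character, or `dim W = 1` and `μ`
conjugate symplectic»).  NOTHING IS ASSERTED: a consumer supplies the dictionary from its own model and takes `(h : X.ThmB4_1)` etc. as explicit hypotheses — never
`∀ X, X.ThmB4_1`, which is junk-false.  The tree's REAL-OBJECT currency for the conclusion «`V_π = Θ^V_{−W}(π_W)`, `dim W = 1`» is ★ `Liu2021.MeetsThetaLiftFromLine`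
(`ThetaLiftFromLineMeets.lean`); the junction from this dictionary to it is the consumer's (letter `StubHolCotMeetsThetaLine` of the T5 Lines draft).

NOT here: the `L`-functions, Eisenstein series, Weil representation and theta kernel themselves (★ `Weil1964.ThetaKernelDatum`, ★ `GelbartRogawski1991.UnitaryDualPair.
thetaKernelDatum` are the tree's real objects); §B.3 (the proof of Thm. B.4); Cor. B.6 (2)(3) (residual representations `R_{s_max}`, multiplicity `m_cusp(π) = 1` — the
«≤ 1» half of Prop. 4.13, owned by programme P3 ∕ P5 in the cell); [BergeronMillsonMoeglin2016Balls, Prop. 13.4] (the SOURCE of the pole, ★ `BMMArchSpectrum.Prop_13_4`).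
HC_CM is proved only modulo the printed citations until rung 0 closes; this file asserts nothing and adds no named fact (debt 0).

## References

* [Liu2021] Y. Liu, Camb. J. Math. 9 (2021): App. B Def. B.2–B.3 p. 96, convention p. 97, Thm. B.4 p. 98, Cor. B.5 p. 98, Cor. B.6 p. 99, §B.3 pp. 100–105; Remark after
  Def. 4.1 p. 41; proof of Prop. 4.13 Case 1 p. 48 (TeX l. 4232, 4249, 4274, 4278–4299, 4301–4313, 4319–4348, 1904–1906, 2133–2137).
* [GinzburgJiangSoudry2009] D. Ginzburg, D. Jiang, D. Soudry, J. Inst. Math. Jussieu 8 (2009) 693–741, Thm. 1.1 (held `paper:doi-10-1017-s1474748009000097`).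
* [JiangWu2014] D. Jiang, C. Wu, J. Number Theory 161 (2016) 88–118 (arXiv:1409.0767, held), Thm. 3.1, Thm. 3.3.  [Wu2022] C. Wu, Pacific J. Math. 317 (2022) 207–237
  (arXiv:2104.11954, held), Thm. 1.  [Wu2013] C. Wu, J. Number Theory 133 (2013) 3296–3318, Thm. 5.1, 5.3.
* [SunZhu2014] B. Sun, C.-B. Zhu, J. Amer. Math. Soc. 28 (2015) 939–983, Thm. 1.10.  [HarrisKudlaSweet1996] M. Harris, S. Kudla, W. J. Sweet, J. AMS 9 (1996), Lemma 1.1.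
* [BergeronMillsonMoeglin2016Balls] Acta Math. 216 (2016), Prop. 13.4 p. 102, Thm. 10.1 p. 79 (the analogous «pole ⇒ theta» theorem).
-/

noncomputable section

namespace Literature.NumberTheory.Automorphic.Liu2021.AppendixB

universe u

/-- **Posited primitives** for [Liu2021, App. B §B.2] (see the module docstring for the verbatim setting).  Parameters of the intended meaning that do not appear as
fields: the CM extension `E/F` (`F` totally real), the hermitian space `V` of rank `n`, `G = U(V)`, the additive character `ψ_F`, the finite set `S`.
Fields:
* `n` — `rank V` (`n ≥ 1`);
* `CuspRep` — cuspidal realizations `V_π ⊆ L²_cusp(G)` of irreducible admissible `π` (Def. B.2 (2));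
* `Char` — STRICTLY UNITARY automorphic characters `μ : E^×\𝔸_E^× → ℂ^×` (Def. B.3);
* `IsConjOrthogonal μ` ∕ `IsConjSymplectic μ` — `μ|𝔸_F^× = 1` ∕ `μ|𝔸_F^× = μ_{E/F}` (Def. 4.1);
* `HasPole V_π μ s₀` — «`L^S(s, π × μ) · L^S(2s, μ, As^{(−1)^n})` has a pole at `s₀`» (Thm. B.4 (1)(a); independent of the admissible `S`);
* `EisPole V_π μ s` — «`{E_Q(g; f_s) | f ∈ I(V_π ⊠ μᶜ)}` has a pole at `s`» (Thm. B.4 (1)(b));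
* `SkewHerm` — isomorphism classes of non-degenerate skew-hermitian spaces `W` over `E`, `dim W = dim_E W` (the zero space included);
* `ThetaNonzero V_π μ W` — «`Θ^W_{(μ,ν),V}(V_π) ≠ 0` for some (equivalently, by the footnote to (1c), every) `ν` with `ν|𝔸_F^× = μ_{E/F}^n`»;
* `LiftCuspidal V_π μ W` — «`Θ^W_{(μ,ν),V}(V_π)` is cuspidal» (hypothesis of Cor. B.6);
* `LiftIrreducible V_π μ W` — «`Θ^W_{(μ,ν),V}(V_π)` is an irreducible representation of `U(W)(𝔸_F)`» (Cor. B.6 (1));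
* `IsDoubleTheta V_π μ W` — «`V_π = Θ^V_{(μ⁻¹,ν⁻¹),−W}(Θ^W_{(μ,ν),V}(V_π))`» ((B.1) of Cor. B.6 (1));
* `IsCharacter V_π` — «`V_π` is a character» (`π` one-dimensional; proof of Prop. 4.13, l. 2136).
[cite: Liu2021, App. B Def. B.2, Def. B.3 (p. 96), §B.2 (p. 96–97), Thm. B.4 (p. 98), Cor. B.6 (p. 99)] -/
structure ThetaPoleDictionary : Type (u + 1) where
  /-- `n = rank V` -/
  n : ℕ
  /-- cuspidal realizations `V_π` (Def. B.2) -/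
  CuspRep : Type u
  /-- strictly unitary automorphic characters `μ` of `𝔸_E^×` (Def. B.3) -/
  Char : Type u
  /-- `μ|𝔸_F^× = 1` (Def. 4.1) -/
  IsConjOrthogonal : Char → Prop
  /-- `μ|𝔸_F^× = μ_{E/F}` (Def. 4.1) -/
  IsConjSymplectic : Char → Prop
  /-- «`L^S(s, π × μ) · L^S(2s, μ, As^{(−1)^n})` has a pole at `s₀`» -/
  HasPole : CuspRep → Char → ℂ → Prop
  /-- «`{E_Q(g; f_s) | f ∈ I(V_π ⊠ μᶜ)}` has a pole at `s`» -/
  EisPole : CuspRep → Char → ℂ → Prop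
  /-- isomorphism classes of skew-hermitian spaces `W` over `E` -/
  SkewHerm : Type u
  /-- `dim_E W` -/
  dim : SkewHerm → ℕ
  /-- «`Θ^W_{(μ,ν),V}(V_π) ≠ 0` (for some, equivalently every, admissible `ν`)» -/
  ThetaNonzero : CuspRep → Char → SkewHerm → Prop
  /-- «`Θ^W_{(μ,ν),V}(V_π)` is cuspidal» -/
  LiftCuspidal : CuspRep → Char → SkewHerm → Prop
  /-- «`Θ^W_{(μ,ν),V}(V_π)` is an irreducible representation of `U(W)(𝔸_F)`» -/
  LiftIrreducible : CuspRep → Char → SkewHerm → Prop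
  /-- «`V_π = Θ^V_{(μ⁻¹,ν⁻¹),−W}(Θ^W_{(μ,ν),V}(V_π))`» -/
  IsDoubleTheta : CuspRep → Char → SkewHerm → Prop
  /-- «`V_π` is a character» -/
  IsCharacter : CuspRep → Prop

namespace ThetaPoleDictionary

variable (X : ThetaPoleDictionary.{u})

/-- P (definition, Def. 4.1 + Remark, l. 1900–1906, p. 41): «conjugate self-dual … It is either conjugate orthogonal or conjugate symplectic, but not both» — read
here as the disjunction (the exclusion is `Exclusive`). [cite: Liu2021, Def. 4.1 and the Remark following it (p. 41)] -/
def IsConjSelfDual (μ : X.Char) : Prop := X.IsConjOrthogonal μ ∨ X.IsConjSymplectic μ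

/-- P (Remark after Def. 4.1, l. 1905, p. 41): «It is either conjugate orthogonal or conjugate symplectic, but not both.» — the exclusion half (for a quadratic `E/F`,
`μ_{E/F} ≠ 1`). [cite: Liu2021, Remark after Def. 4.1 (p. 41)] -/
def Exclusive : Prop := ∀ μ : X.Char, ¬ (X.IsConjOrthogonal μ ∧ X.IsConjSymplectic μ)

/-- P (the CONVENTION of l. 4274, p. 97): «if `μ|𝔸_F^× ≠ μ_{E/F}^m` with `m := dim_E W`, then `Θ^W_{(μ,ν),V}(V_π) = 0`» — contraposed: a non-zero theta lift to `W` forces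
`μ|𝔸_F^× = μ_{E/F}^{dim W}`, i.e. `μ` conjugate orthogonal for `dim W` even and conjugate symplectic for `dim W` odd (`μ_{E/F}` quadratic).
[cite: Liu2021, App. B §B.2 (l. 4274, p. 97); Def. 4.1] -/
def Convention : Prop :=
  ∀ (V : X.CuspRep) (μ : X.Char) (W : X.SkewHerm), X.ThetaNonzero V μ W →
    (Even (X.dim W) → X.IsConjOrthogonal μ) ∧ (Odd (X.dim W) → X.IsConjSymplectic μ)

/-- P. **Theorem B.4 (1)**, AS PRINTED: for `V_π` cuspidal, `μ` strictly unitary and `s₀ ∈ ℂ` with `Re(s₀) > 0`: «(a) `L^S(s, π × μ)·L^S(2s, μ, As^{(−1)^n})` has a pole at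
`s₀`» ⇒ «(b) `{E_Q(g; f_s)}` has a pole at `s₀ + j` for some integer `j ≥ 0`» ⇒ «(c) `Θ^W_{(μ,ν),V}(V_π) ≠ 0` for some skew-hermitian space `W` of dimension `n + 1 − 2s₀`
and some `ν`».  Typed as the two implications, the dimension clause in `ℂ` exactly as printed (so (c) forces `n + 1 − 2s₀ ∈ ℕ`).  «the unitary version of a weaker form
of [GJS, Theorem 1.1]»; published unitary proof of (a)⇒(c): [JiangWu2014, Thm. 3.3 (1)] (`LO ≤ 2j + ε_χ`), [Wu2022, Thm. 1].  Nothing is asserted.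
[cite: Liu2021, Thm. B.4 (1) (l. 4278–4293, p. 98)] [cite: JiangWu2014, Thm. 3.1, Thm. 3.3] [cite: GinzburgJiangSoudry2009, Thm. 1.1] -/
def ThmB4_1 : Prop :=
  ∀ (V : X.CuspRep) (μ : X.Char) (s₀ : ℂ), 0 < s₀.re →
    (X.HasPole V μ s₀ → ∃ j : ℕ, X.EisPole V μ (s₀ + j)) ∧
    ((∃ j : ℕ, X.EisPole V μ (s₀ + j)) → ∃ W : X.SkewHerm, (X.dim W : ℂ) = X.n + 1 - 2 * s₀ ∧ X.ThetaNonzero V μ W)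

/-- P. **Theorem B.4 (2)**, AS PRINTED: «The skew-hermitian space `W` in (1c) is unique up to isomorphism» (on isomorphism classes: two `W` of the same dimension with
non-zero lift coincide; proof l. 4535: [SunZhu2014, Thm. 1.10]).  Not used by the existence half of Prop. 4.13.
[cite: Liu2021, Thm. B.4 (2) (l. 4298, p. 98)] [cite: SunZhu2014, Thm. 1.10] -/
def ThmB4_2 : Prop :=
  ∀ (V : X.CuspRep) (μ : X.Char) (W W' : X.SkewHerm),
    X.ThetaNonzero V μ W → X.ThetaNonzero V μ W' → X.dim W = X.dim W' → W = W'

/-- P. **Corollary B.5**, AS PRINTED (poles in `Re(s) > 0`): «(1) If `μ` is not conjugate self-dual, then `Pol^S_{π,μ}` is empty. (2) If `μ` is conjugate orthogonal … then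
`Pol^S_{π,μ} ⊆ {(n+1)/2, (n−1)/2, …, (n+1)/2 − ⌊n/2⌋}`. (3) If `μ` is conjugate symplectic … then `Pol^S_{π,μ} ⊆ {n/2, (n−2)/2, …, n/2 − ⌊(n−1)/2⌋}`.»  The two finite sets
are typed as `{(n+1)/2 − k | k ∈ ℕ, 2k ≤ n}` and `{n/2 − k | k ∈ ℕ, 2k + 1 ≤ n}` (same sets: `k ≤ ⌊n/2⌋`, resp. `k ≤ ⌊(n−1)/2⌋`).  PROVED below from `ThmB4_1`,
`Convention`, `Exclusive` (`corB5_of_thmB4`), as the print says. [cite: Liu2021, Cor. B.5 (l. 4301–4313, p. 98)] -/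
def CorB5 : Prop :=
  ∀ (V : X.CuspRep) (μ : X.Char) (s₀ : ℂ), 0 < s₀.re → X.HasPole V μ s₀ →
    X.IsConjSelfDual μ ∧
    (X.IsConjOrthogonal μ → ∃ k : ℕ, 2 * k ≤ X.n ∧ s₀ = ((X.n : ℂ) + 1) / 2 - k) ∧
    (X.IsConjSymplectic μ → ∃ k : ℕ, 2 * k + 1 ≤ X.n ∧ s₀ = (X.n : ℂ) / 2 - k)

/-- P. **Corollary B.6 (1)**, AS PRINTED: «Suppose that `Θ^W_{(μ,ν),V}(V_π)` is cuspidal. Then (1) The space `Θ^W_{(μ,ν),V}(V_π)` is an irreducible representation of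
`U(W)(𝔸_F)`; and `V_π = Θ^V_{(μ⁻¹,ν⁻¹),−W}(Θ^W_{(μ,ν),V}(V_π))`» (for the `W` of Thm. B.4 at the largest Eisenstein pole; typed for every `W` with non-zero cuspidal
lift, which is how the proof of Prop. 4.13 applies it at `W = 0` and `dim W = 1`).  Proof in print: [Wu2013, Thm. 5.3, Thm. 5.1].  Nothing is asserted.
[cite: Liu2021, Cor. B.6 (1) (l. 4319–4326, p. 99; proof l. 4339)] [cite: Wu2013, Thm. 5.1, Thm. 5.3] -/
def CorB6_1 : Prop :=
  ∀ (V : X.CuspRep) (μ : X.Char) (W : X.SkewHerm), X.ThetaNonzero V μ W → X.LiftCuspidal V μ W →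
    X.LiftIrreducible V μ W ∧ X.IsDoubleTheta V μ W

/-- P (step of the printed proof of Prop. 4.13, Case 1, l. 2135–2136, p. 48): «If `s₀ = (n+1)/2`, then Theorem B.4 implies that `Θ^W_{(μ,ν),V}(V_π) ≠ {0}`, where `W` is
the zero skew-hermitian space. By Corollary B.6 (1), `V_π` is a character» — i.e. a double theta lift through the ZERO space (`U(0) = 1`) is one-dimensional.  Typed as
the inference actually used: `dim W = 0`, non-zero lift, (B.1) ⟹ `V_π` is a character.  (The lift to `W = 0` is automatically cuspidal: `[U(0)]` is a point.)
[cite: Liu2021, proof of Prop. 4.13 Case 1 (l. 2135–2136, p. 48); Cor. B.6 (1)] -/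
def ZeroDimLiftIsCharacter : Prop :=
  ∀ (V : X.CuspRep) (μ : X.Char) (W : X.SkewHerm), X.dim W = 0 → X.ThetaNonzero V μ W → X.IsDoubleTheta V μ W → X.IsCharacter V

/-! ### Proved: Corollary B.5 from Theorem B.4 («This is a direct consequence of Theorem B.4») -/

variable {X}

/-- K. A pole at `s₀` (`Re s₀ > 0`) yields a skew-hermitian `W` with `dim W = n + 1 − 2s₀` and `Θ^W(V_π) ≠ 0` (Thm. B.4 (1), (a)⇒(b)⇒(c) composed).
[cite: Liu2021, Thm. B.4 (1) (p. 98)] -/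
theorem exists_W_of_hasPole (h : X.ThmB4_1) {V : X.CuspRep} {μ : X.Char} {s₀ : ℂ} (hs : 0 < s₀.re) (hp : X.HasPole V μ s₀) :
    ∃ W : X.SkewHerm, (X.dim W : ℂ) = X.n + 1 - 2 * s₀ ∧ X.ThetaNonzero V μ W :=
  (h V μ s₀ hs).2 ((h V μ s₀ hs).1 hp)

/-- K. **Cor. B.5 (1)**: a pole in `Re(s) > 0` forces `μ` conjugate self-dual (Thm. B.4 gives a non-zero lift to some `W`; the convention l. 4274 gives
`μ|𝔸_F^× = μ_{E/F}^{dim W}`). [cite: Liu2021, Cor. B.5 (1) (p. 98)] -/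
theorem isConjSelfDual_of_hasPole (h : X.ThmB4_1) (hc : X.Convention) {V : X.CuspRep} {μ : X.Char} {s₀ : ℂ} (hs : 0 < s₀.re)
    (hp : X.HasPole V μ s₀) : X.IsConjSelfDual μ := by
  obtain ⟨W, -, hW⟩ := exists_W_of_hasPole h hs hp
  rcases Nat.even_or_odd (X.dim W) with he | ho
  · exact Or.inl ((hc V μ W hW).1 he)
  · exact Or.inr ((hc V μ W hW).2 ho)

/-- K. **Cor. B.5 (2)**: for `μ` conjugate orthogonal the poles lie in `{(n+1)/2 − k | 2k ≤ n}` (`dim W = 2k` is even by the convention and the exclusion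
«not both»; `Re s₀ > 0` excludes `2k = n + 1`). [cite: Liu2021, Cor. B.5 (2) (p. 98)] -/
theorem corB5_orth_of_thmB4 (h : X.ThmB4_1) (hc : X.Convention) (hx : X.Exclusive) {V : X.CuspRep} {μ : X.Char} {s₀ : ℂ} (hs : 0 < s₀.re)
    (hp : X.HasPole V μ s₀) (hμ : X.IsConjOrthogonal μ) : ∃ k : ℕ, 2 * k ≤ X.n ∧ s₀ = ((X.n : ℂ) + 1) / 2 - k := by
  obtain ⟨W, hdim, hW⟩ := exists_W_of_hasPole h hs hp
  rcases Nat.even_or_odd (X.dim W) with ⟨k, hk⟩ | ho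
  · refine ⟨k, ?_, ?_⟩
    · -- `2k = dim W = n + 1 − 2 s₀` with `Re s₀ > 0` ⟹ `2k < n + 1`
      have hre : ((X.dim W : ℂ)).re = (X.n : ℝ) + 1 - 2 * s₀.re := by
        rw [hdim]; simp
      have h1 : ((X.dim W : ℂ)).re = (X.dim W : ℝ) := by simp
      have h2 : (X.dim W : ℝ) < (X.n : ℝ) + 1 := by rw [← h1, hre]; linarith
      have h3 : X.dim W < X.n + 1 := by exact_mod_cast h2
      omega
    · have hk' : (X.dim W : ℂ) = (k : ℂ) + k := by rw [hk]; push_cast; ring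
      rw [hk'] at hdim
      linear_combination (1 / 2 : ℂ) * hdim
  · exact absurd ⟨hμ, (hc V μ W hW).2 ho⟩ (hx μ)

/-- K. **Cor. B.5 (3)**: for `μ` conjugate symplectic the poles lie in `{n/2 − k | 2k + 1 ≤ n}` (`dim W = 2k + 1` odd; `Re s₀ > 0` gives `2k + 1 ≤ n`).
[cite: Liu2021, Cor. B.5 (3) (p. 98)] -/
theorem corB5_sympl_of_thmB4 (h : X.ThmB4_1) (hc : X.Convention) (hx : X.Exclusive) {V : X.CuspRep} {μ : X.Char} {s₀ : ℂ} (hs : 0 < s₀.re)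
    (hp : X.HasPole V μ s₀) (hμ : X.IsConjSymplectic μ) : ∃ k : ℕ, 2 * k + 1 ≤ X.n ∧ s₀ = (X.n : ℂ) / 2 - k := by
  obtain ⟨W, hdim, hW⟩ := exists_W_of_hasPole h hs hp
  rcases Nat.even_or_odd (X.dim W) with he | ⟨k, hk⟩
  · exact absurd ⟨(hc V μ W hW).1 he, hμ⟩ (hx μ)
  · refine ⟨k, ?_, ?_⟩
    · have hre : ((X.dim W : ℂ)).re = (X.n : ℝ) + 1 - 2 * s₀.re := by
        rw [hdim]; simp
      have h1 : ((X.dim W : ℂ)).re = (X.dim W : ℝ) := by simp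
      have h2 : (X.dim W : ℝ) < (X.n : ℝ) + 1 := by rw [← h1, hre]; linarith
      have h3 : X.dim W < X.n + 1 := by exact_mod_cast h2
      omega
    · have hk' : (X.dim W : ℂ) = 2 * (k : ℂ) + 1 := by rw [hk]; push_cast; ring
      rw [hk'] at hdim
      linear_combination (1 / 2 : ℂ) * hdim

/-- K. **Corollary B.5 is a consequence of Theorem B.4 (1)**, the convention l. 4274 and the Remark after Def. 4.1 — «This is a direct consequence of Theorem B.4»,
kernel-checked. [cite: Liu2021, Cor. B.5 and its proof (l. 4301–4313, p. 98)] -/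
theorem corB5_of_thmB4 (h : X.ThmB4_1) (hc : X.Convention) (hx : X.Exclusive) : X.CorB5 :=
  fun _ _ _ hs hp =>
    ⟨isConjSelfDual_of_hasPole h hc hs hp, corB5_orth_of_thmB4 h hc hx hs hp, corB5_sympl_of_thmB4 h hc hx hs hp⟩

/-! ### Proved: the Case-1 dichotomy of the proof of Proposition 4.13 (l. 2133–2137) -/

/-- K. **Case 1 of the proof of Prop. 4.13, first half** (l. 2135–2137, p. 48): if `L^S(s, π × μ)·L^S(2s, μ, As)` has a pole at a REAL `s₀ ≥ n/2` (the output of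
[BergeronMillsonMoeglin2016Balls, Prop. 13.4]), then EITHER `s₀ = (n+1)/2`, `μ` is conjugate orthogonal and `V_π` lifts non-trivially to the ZERO skew-hermitian space,
OR `s₀ = n/2`, `μ` is conjugate symplectic and `V_π` lifts non-trivially to a skew-hermitian LINE (`dim W = 1`).  («By Corollary B.5, `s₀` is either `(n+1)/2` or `n/2`,
not both … By Theorem B.4, we have a one-dimensional skew-hermitian space `W` …».) [cite: Liu2021, proof of Prop. 4.13 Case 1 (l. 2135–2137, p. 48); Thm. B.4; Cor. B.5] -/
theorem case1_dichotomy (h : X.ThmB4_1) (hc : X.Convention) {V : X.CuspRep} {μ : X.Char} {s₀ : ℝ} (hs : (X.n : ℝ) / 2 ≤ s₀) (hn : 1 ≤ X.n)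
    (hp : X.HasPole V μ (s₀ : ℂ)) :
    (s₀ = ((X.n : ℝ) + 1) / 2 ∧ X.IsConjOrthogonal μ ∧ ∃ W : X.SkewHerm, X.dim W = 0 ∧ X.ThetaNonzero V μ W) ∨
    (s₀ = (X.n : ℝ) / 2 ∧ X.IsConjSymplectic μ ∧ ∃ W : X.SkewHerm, X.dim W = 1 ∧ X.ThetaNonzero V μ W) := by
  have hs0 : 0 < (s₀ : ℂ).re := by
    simp only [Complex.ofReal_re]
    have : (0 : ℝ) < X.n := by exact_mod_cast hn
    linarith
  obtain ⟨W, hdim, hW⟩ := exists_W_of_hasPole h hs0 hp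
  -- real form of the dimension identity
  have hdimR : (X.dim W : ℝ) = (X.n : ℝ) + 1 - 2 * s₀ := by
    have := congrArg Complex.re hdim
    simpa using this
  have hle : (X.dim W : ℝ) ≤ 1 := by rw [hdimR]; linarith
  have hd : X.dim W ≤ 1 := by exact_mod_cast hle
  rcases Nat.le_one_iff_eq_zero_or_eq_one.1 hd with h0 | h1
  · refine Or.inl ⟨?_, (hc V μ W hW).1 (by rw [h0]; exact ⟨0, rfl⟩), W, h0, hW⟩
    have : (X.dim W : ℝ) = 0 := by exact_mod_cast h0
    linarith
  · refine Or.inr ⟨?_, (hc V μ W hW).2 (by rw [h1]; exact ⟨0, rfl⟩), W, h1, hW⟩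
    have : (X.dim W : ℝ) = 1 := by exact_mod_cast h1
    linarith

/-- K. **Case 1, second half** (l. 2135–2137 with Cor. B.6 (1)): if moreover a non-zero double theta lift through the ZERO space makes `V_π` a character
(`ZeroDimLiftIsCharacter`, «By Corollary B.6 (1), `V_π` is a character»), the lift to `W = 0` is cuspidal and satisfies (B.1) (`CorB6_1`), and `V_π` is NOT a character
(«hence `H¹(𝔤, K_G; π_∞) = {0}`, which is a contradiction»), then `s₀ = n/2`, `μ` is conjugate symplectic and `V_π` has a non-zero theta lift to a skew-hermitian LINE.
[cite: Liu2021, proof of Prop. 4.13 Case 1 (l. 2135–2137, p. 48); Cor. B.6 (1) (p. 99)] -/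
theorem case1_line (h : X.ThmB4_1) (hc : X.Convention) (h6 : X.CorB6_1) (hz : X.ZeroDimLiftIsCharacter)
    (hcusp0 : ∀ (V : X.CuspRep) (μ : X.Char) (W : X.SkewHerm), X.dim W = 0 → X.ThetaNonzero V μ W → X.LiftCuspidal V μ W)
    {V : X.CuspRep} {μ : X.Char} {s₀ : ℝ} (hs : (X.n : ℝ) / 2 ≤ s₀) (hn : 1 ≤ X.n) (hp : X.HasPole V μ (s₀ : ℂ)) (hnot : ¬ X.IsCharacter V) :
    s₀ = (X.n : ℝ) / 2 ∧ X.IsConjSymplectic μ ∧ ∃ W : X.SkewHerm, X.dim W = 1 ∧ X.ThetaNonzero V μ W := by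
  rcases case1_dichotomy h hc hs hn hp with ⟨-, -, W, h0, hW⟩ | hline
  · exact absurd (hz V μ W h0 hW (h6 V μ W hW (hcusp0 V μ W h0 hW)).2) hnot
  · exact hline

/-- K (sanity, `n = 3`): in Case 1 with `n = 3` the two candidate poles are `s₀ = 2` (conjugate orthogonal, `W = 0`) and `s₀ = 3/2` (conjugate symplectic, `dim W = 1`) —
the instance consumed by letter #87 of the cell. [cite: Liu2021, proof of Prop. 4.13 Case 1 (p. 48)] -/
theorem case1_dichotomy_three (h : X.ThmB4_1) (hc : X.Convention) (h3 : X.n = 3) {V : X.CuspRep} {μ : X.Char} {s₀ : ℝ} (hs : (3 : ℝ) / 2 ≤ s₀)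
    (hp : X.HasPole V μ (s₀ : ℂ)) :
    (s₀ = 2 ∧ X.IsConjOrthogonal μ ∧ ∃ W : X.SkewHerm, X.dim W = 0 ∧ X.ThetaNonzero V μ W) ∨
    (s₀ = 3 / 2 ∧ X.IsConjSymplectic μ ∧ ∃ W : X.SkewHerm, X.dim W = 1 ∧ X.ThetaNonzero V μ W) := by
  have hs' : (X.n : ℝ) / 2 ≤ s₀ := by rw [h3]; push_cast; linarith
  rcases case1_dichotomy h hc hs' (by omega) hp with ⟨hs0, ho, hW⟩ | ⟨hs0, hsy, hW⟩
  · left; refine ⟨?_, ho, hW⟩; rw [hs0, h3]; norm_num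
  · right; refine ⟨?_, hsy, hW⟩; rw [hs0, h3]; norm_num

end ThetaPoleDictionary

end Literature.NumberTheory.Automorphic.Liu2021.AppendixB

end
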